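import Mathlib
import Literature.Combinatorics.Optimization.NonnegativeRankJuntaDegree
import Literature.Combinatorics.Optimization.KnapsackPseudoDensity
import HarnessLib

/-!
# The lopsided measure on `{0,1}^m`: Lemma 7.3 and Theorem 7.4 of Lee–Raghavendra–Steurer 2015 (§7.2) — PROVED

§7.2 ("The correlation polytope and lopsided disjointness", p. 28) of [LeeRaghavendraSteurer2015]
applies Theorem 7.2 (file `NonnegativeRankJuntaDegree.lean`) to the quadric `f(x) = (1 − Σ_i x_i)²`
(eq. (7.10), the function of Prop. 1.11) under the biased product measure `μ(0) = 1 − 2/m`,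
`μ(1) = 2/m`.

* **Lemma 7.3** (p. 28): "There is a constant `ε₀ > 0` such that for all `m ≥ 3`, the following holds.
  Define `f : {0,1}^m → ℝ₊` by `f(x) = (1 − Σ_{i=1}^m x_i)²`, and let `μ` be the measure on `{0,1}`
  satisfying `μ(0) = 1 − 2/m` and `μ(1) = 2/m`. Then, `juntadeg^{ε₀}(f; μ^m) ≥ m/2 + 1`."
  — `LeeRaghavendraSteurer2015_lemma73`: an explicit density `D` (`Lopsided.density`) which is
  `d`-local w.r.t. `μ^m` for every `d` with `2(d − 1) ≤ m` and has `E_{μ^m}[D f] < −ε₀‖D‖_∞ E_{μ^m} f`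
  with `ε₀ = e^{−6}/16`; hence `juntadeg^{ε₀}(f; μ^m) ≥ ⌊m/2⌋ + 2 ≥ m/2 + 1`
  (`LeeRaghavendraSteurer2015_lemma73_approxJuntaDegree`).
  RECORDED: the printed witness is displayed as "`D(x) = −1/μ^m(𝟎)` (`|x| = 0`), `2/(m μ^m(x))`
  (`|x| = 1`), `0` (`|x| > 1`)", while the verification displayed beneath it
  ("`E D 𝟙_b = β(m − |S|) − (1 − 2/m)^m = (1 − 2/m)^{m−1}(1 − 2(|S|−1)/m)`, nonnegative as long as
  `|S| ≤ m/2 + 1`") is the computation for the density PROPORTIONAL TO THE SIGN PATTERN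
  `−𝟙[x = 𝟎] + 𝟙[|x| = 1]`; with the displayed `D` (which carries the factors `1/μ^m(x)`) one gets
  `E D 𝟙_b = 1 − 2|S|/m`, i.e. locality only up to `|S| ≤ m/2`.  We use the normalised sign-pattern
  density `D = (−𝟙[x=𝟎] + 𝟙[|x|=1]) / (mβ − α)`, `α = μ^m(𝟎) = (1−2/m)^m`, `β = μ^m(e_i) =
  (2/m)(1−2/m)^{m−1}`, for which the displayed verification and the stated threshold `m/2 + 1` hold:
  `E D = 1`, `E[D 𝟙_b] ≥ 0` for `|S| ≤ m/2 + 1`, `E[D f] = −α/(mβ − α) = −(m−2)/(m+2) ≤ −1/5`,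
  `‖D‖_∞ = 1/(mβ − α) ≤ (1 − 2/m)^{−m} ≤ e^6` (from `log(1 − 2/m) ≥ −2/(m−2)`), and
  `E_{μ^m} f = 3 − 4/m` (`Lopsided.muExpect_quadric`).
* **Theorem 7.4** (p. 28): "There is a constant `c > 0` such that for every `m ≥ 3` and `n ≥ 2m`,
  we have `nnr(M_n^f) ≥ (cn/(m³ log n))^{m/2}`." — `LeeRaghavendraSteurer2015_thm74`, PROVED from
  `LeeRaghavendraSteurer2015_thm72_lower'` with `d = ⌊m/2⌋ + 1` (explicit `c`; the real exponent
  `m/2` as `Real.rpow`).  "In particular … `nnr(CORR_n) ≥ 2^{Ω(n^{1/3})}`" is not restated (it needs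
  the submatrix transfer of Prop. 1.11 in nonnegative-rank form, cf. the tree's psd version
  `HasPsdFactorization.patternMatrix_of_corrSlack`).
* **Corollary 7.5** (lopsided unique disjointness: the same bound for EVERY matrix
  `M : ([n] choose m) × 2^{[n]} → ℝ₊` with `M(S,T) = 1` if `|S ∩ T| = 1` and `0` if `|S ∩ T| = 0`) is
  NOT typed: the remark preceding it ("the lower bound on `nnr(M_n^f)` also applies in this general
  setting") is not substantiated by the printed proof of Thm 7.2, whose steps (7.5)–(7.6)
  (`Σ_i λ_i(S) = ‖f‖₁`, `λ_i(S) ≤ ‖f‖_∞/τ`) use all entries of the matrix, not only those with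
  `|S ∩ T| ≤ 1`; the pattern-matrix case `M = M_n^f` is Theorem 7.4.

0 named facts, no `sorry`.  Source: J. R. Lee, P. Raghavendra, D. Steurer, STOC 2015
[LeeRaghavendraSteurer2015]; held text `paper:arxiv-1411.6317` (arXiv rendering), §7.2 p. 28.
-/

noncomputable section

open Finset Real

namespace Literature.Combinatorics.Optimization

namespace Lopsided

variable {m : ℕ}

/-! ### The measure, the quadric, the two atoms `𝟎` and `e_i` -/

/-- The lopsided measure on `{0,1}`: `μ(1) = 2/m`, `μ(0) = 1 − 2/m`. [cite: LeeRaghavendraSteurer2015, Lemma 7.3 (p. 28)] -/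
def weight (m : ℕ) : Bool → ℝ := fun b => if b then 2 / m else 1 - 2 / m

/-- The product measure `μ^m` on `{0,1}^m`. [cite: LeeRaghavendraSteurer2015, Lemma 7.3 (p. 28)] -/
abbrev measure (m : ℕ) : (Fin m → Bool) → ℝ := prodWeight (weight m) m

/-- **`f(x) = (1 − Σ_i x_i)²`**. [cite: LeeRaghavendraSteurer2015, eq. (7.10) (p. 28)] -/
def quadric (m : ℕ) (x : Fin m → Bool) : ℝ := (1 - ((trueSet x).card : ℝ)) ^ 2

/-- The vertex `e_i` (Hamming weight one). [cite: LeeRaghavendraSteurer2015, Lemma 7.3 (p. 28: "β = μ^m(1,0,…,0)")] -/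
def unitVec (i : Fin m) : Fin m → Bool := fun j => decide (j = i)

/-- `2/m < 1` for `m ≥ 3`. [folklore] -/
private theorem two_div_lt_one (hm : 3 ≤ m) : (2 : ℝ) / m < 1 := by
  have : (3 : ℝ) ≤ m := by exact_mod_cast hm
  rw [div_lt_one (by linarith)]; linarith

/-- For `m ≥ 3` the lopsided weight is a probability measure of full support. [cite: LeeRaghavendraSteurer2015, Lemma 7.3 (p. 28)] -/
theorem weight_pos (hm : 3 ≤ m) (b : Bool) : 0 < weight m b := by
  have : (3 : ℝ) ≤ m := by exact_mod_cast hm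
  unfold weight; split_ifs
  · positivity
  · linarith [two_div_lt_one hm]

/-- `μ` is a probability weight (`m ≥ 3`). [cite: LeeRaghavendraSteurer2015, Lemma 7.3 (p. 28)] -/
theorem isProbWeight_weight (hm : 3 ≤ m) : IsProbWeight (weight m) where
  nonneg b := (weight_pos hm b).le
  sum_eq_one := by simp [weight]

/-- `μ^m` is a probability weight. [cite: LeeRaghavendraSteurer2015, Lemma 7.3 (p. 28)] -/
theorem isProbWeight_measure (hm : 3 ≤ m) : IsProbWeight (measure m) :=
  isProbWeight_piWeight (isProbWeight_weight hm)

/-- `μ^m` has full support (`m ≥ 3`). [cite: LeeRaghavendraSteurer2015, Lemma 7.3 (p. 28)] -/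
theorem measure_pos (hm : 3 ≤ m) (x : Fin m → Bool) : 0 < measure m x :=
  prod_pos fun i _ => weight_pos hm (x i)

/-- The support of `𝟎` is empty. [folklore] -/
@[simp] private theorem trueSet_zero : trueSet (fun _ : Fin m => false) = ∅ := by
  ext i; simp [mem_trueSet]

/-- The support of `e_i` is `{i}`. [folklore] -/
@[simp] private theorem trueSet_unitVec (i : Fin m) : trueSet (unitVec i) = {i} := by
  ext j; simp [mem_trueSet, unitVec]

/-- Hamming weight `0` means `x = 𝟎`. [folklore] -/
private theorem eq_zero_of_card_trueSet {x : Fin m → Bool} (h : (trueSet x).card = 0) :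
    x = fun _ => false := by
  funext j
  have : j ∉ trueSet x := by rw [Finset.card_eq_zero.mp h]; simp
  simpa [mem_trueSet] using this

/-- Hamming weight `1` means `x = e_i` for some `i`. [folklore] -/
private theorem eq_unitVec_of_card_trueSet {x : Fin m → Bool} (h : (trueSet x).card = 1) :
    ∃ i, x = unitVec i := by
  obtain ⟨i, hi⟩ := Finset.card_eq_one.mp h
  refine ⟨i, funext fun j => ?_⟩
  have : j ∈ trueSet x ↔ j = i := by rw [hi]; simp
  simp only [mem_trueSet] at this
  unfold unitVec
  by_cases hj : j = i
  · simp [hj] at this ⊢; exact this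
  · simp [hj] at this ⊢; exact this

/-- `α = μ^m(𝟎) = (1 − 2/m)^m`. [cite: LeeRaghavendraSteurer2015, Lemma 7.3 (p. 28, proof)] -/
theorem measure_zero (m : ℕ) : measure m (fun _ => false) = (1 - 2 / m) ^ m := by
  simp [measure, prodWeight, piWeight, weight]

/-- `β = μ^m(e_i) = (2/m)(1 − 2/m)^{m−1}`. [cite: LeeRaghavendraSteurer2015, Lemma 7.3 (p. 28, proof: "β = (2/m)(1−2/m)^{m−1}")] -/
theorem measure_unitVec (i : Fin m) : measure m (unitVec i) = 2 / m * (1 - 2 / m) ^ (m - 1) := by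
  unfold measure prodWeight piWeight
  rw [← Finset.mul_prod_erase univ (fun j => weight m (unitVec i j)) (mem_univ i)]
  have h1 : weight m (unitVec i i) = 2 / m := by simp [weight, unitVec]
  have h2 : ∀ j ∈ univ.erase i, weight m (unitVec i j) = 1 - 2 / m := by
    intro j hj
    have : j ≠ i := ne_of_mem_erase hj
    simp [weight, unitVec, this]
  rw [h1, prod_congr rfl h2, prod_const, card_erase_of_mem (mem_univ i), card_univ, Fintype.card_fin]

/-! ### Expectations against the two lowest levels -/

/-- `Σ_{x : |x| = 1} h(x) = Σ_i h(e_i)`. [cite: LeeRaghavendraSteurer2015, Lemma 7.3 (p. 28, proof)] -/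
theorem sum_filter_card_eq_one (h : (Fin m → Bool) → ℝ) :
    ∑ x ∈ univ.filter (fun x : Fin m → Bool => (trueSet x).card = 1), h x = ∑ i, h (unitVec i) := by
  rw [← Finset.sum_image (f := h) (s := univ) (g := fun i : Fin m => unitVec i)]
  · congr 1
    ext x
    simp only [mem_filter, mem_univ, true_and, mem_image]
    constructor
    · intro hx
      obtain ⟨i, rfl⟩ := eq_unitVec_of_card_trueSet hx
      exact ⟨i, rfl⟩
    · rintro ⟨i, rfl⟩
      simp
  · intro i _ j _ hij
    have := congrFun hij i
    simpa [unitVec] using this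

/-- The sign pattern of the witness: `−1` at `𝟎`, `+1` on Hamming weight one, `0` above.
[cite: LeeRaghavendraSteurer2015, Lemma 7.3 (p. 28, proof: "D is supported only on |x| ≤ 1")] -/
def signPattern (x : Fin m → Bool) : ℝ :=
  if (trueSet x).card = 0 then -1 else if (trueSet x).card = 1 then 1 else 0

/-- `E_{μ^m}[σ·g] = −α g(𝟎) + β Σ_i g(e_i)` for the sign pattern `σ`. [cite: LeeRaghavendraSteurer2015, Lemma 7.3 (p. 28, proof: "E D 𝟙_b = β(m − |S|) − (1−2/m)^m")] -/
theorem muExpect_signPattern_mul (g : (Fin m → Bool) → ℝ) :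
    muExpect (measure m) (fun x => signPattern x * g x) =
      -((1 - 2 / m) ^ m * g (fun _ => false)) +
        2 / m * (1 - 2 / m) ^ (m - 1) * ∑ i, g (unitVec i) := by
  unfold muExpect
  have hsplit : ∀ x : Fin m → Bool, measure m x * (signPattern x * g x) =
      (if (trueSet x).card = 0 then -(measure m x * g x) else 0) +
      (if (trueSet x).card = 1 then measure m x * g x else 0) := by
    intro x
    unfold signPattern
    split_ifs with h0 h1 <;> simp_all
  rw [Fintype.sum_congr _ _ hsplit, sum_add_distrib, ← Finset.sum_filter, ← Finset.sum_filter]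
  congr 1
  · have : univ.filter (fun x : Fin m → Bool => (trueSet x).card = 0) = {fun _ => false} := by
      ext x
      simp only [mem_filter, mem_univ, true_and, mem_singleton]
      exact ⟨eq_zero_of_card_trueSet, fun h => by subst h; simp⟩
    rw [this, sum_singleton, measure_zero]
  · rw [sum_filter_card_eq_one, mul_sum]
    exact sum_congr rfl fun i _ => by rw [measure_unitVec]

/-- The normalising constant `Z = mβ − α = (1 − 2/m)^{m−1}(1 + 2/m)`. [cite: LeeRaghavendraSteurer2015, Lemma 7.3 (p. 28, proof)] -/
def normConst (m : ℕ) : ℝ := (1 - 2 / (m : ℝ)) ^ (m - 1) * (1 + 2 / m)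

/-- `Z = −α + β·m`. [cite: LeeRaghavendraSteurer2015, Lemma 7.3 (p. 28, proof)] -/
theorem normConst_eq (hm : 3 ≤ m) :
    normConst m = -(1 - 2 / (m : ℝ)) ^ m + 2 / m * (1 - 2 / m) ^ (m - 1) * m := by
  have hm0 : (m : ℝ) ≠ 0 := Nat.cast_ne_zero.mpr (by omega)
  have hpow : (1 - 2 / (m : ℝ)) ^ m = (1 - 2 / m) ^ (m - 1) * (1 - 2 / m) := by
    rw [← pow_succ]; congr 1; omega
  have h2 : (2 : ℝ) / m * (1 - 2 / m) ^ (m - 1) * m = 2 * (1 - 2 / m) ^ (m - 1) := by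
    field_simp
  rw [normConst, hpow, h2]
  ring

/-- `Z > 0` for `m ≥ 3`. [cite: LeeRaghavendraSteurer2015, Lemma 7.3 (p. 28, proof)] -/
theorem normConst_pos (hm : 3 ≤ m) : 0 < normConst m := by
  unfold normConst
  have := two_div_lt_one hm
  have : (0 : ℝ) < 1 - 2 / m := by linarith
  positivity

/-- **The witness pseudo-density** `D = (−𝟙[x=𝟎] + 𝟙[|x|=1]) / (mβ − α)` (see the module docstring for
its relation to the displayed `D`). [cite: LeeRaghavendraSteurer2015, Lemma 7.3 (p. 28, proof)] -/
def density (m : ℕ) (x : Fin m → Bool) : ℝ := signPattern x / normConst m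

/-- `E_{μ^m}[D g] = (−α g(𝟎) + β Σ_i g(e_i)) / Z`. [cite: LeeRaghavendraSteurer2015, Lemma 7.3 (p. 28, proof)] -/
theorem muExpect_density_mul (g : (Fin m → Bool) → ℝ) :
    muExpect (measure m) (fun x => density m x * g x) =
      (-((1 - 2 / m) ^ m * g (fun _ => false)) +
        2 / m * (1 - 2 / m) ^ (m - 1) * ∑ i, g (unitVec i)) / normConst m := by
  rw [← muExpect_signPattern_mul]
  unfold density muExpect
  rw [sum_div]
  exact sum_congr rfl fun x _ => by ring

/-- `E_{μ^m} D = 1`. [cite: LeeRaghavendraSteurer2015, Lemma 7.3 (p. 28, proof: "E_{x∼μ^m} D(x) = −1 + m·(2/m) = 1")] -/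
theorem muExpect_density (hm : 3 ≤ m) : muExpect (measure m) (density m) = 1 := by
  have h := muExpect_density_mul (m := m) (fun _ => 1)
  simp only [mul_one, sum_const, card_univ, Fintype.card_fin, nsmul_eq_mul, mul_one] at h
  rw [h, div_eq_one_iff_eq (normConst_pos hm).ne', normConst_eq hm]

/-- **Locality**: `E_{μ^m}[D g] ≥ 0` for every nonnegative `S`-junta `g` with `2(|S| − 1) ≤ m`
("nonnegative as long as `|S| ≤ m/2 + 1`"). [cite: LeeRaghavendraSteurer2015, Lemma 7.3 (p. 28, proof)] -/
theorem muExpect_density_mul_nonneg (hm : 3 ≤ m) {S : Finset (Fin m)} (hS : 2 * (S.card - 1) ≤ m)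
    {g : (Fin m → Bool) → ℝ} (hg : IsSJunta S g) (hg0 : ∀ x, 0 ≤ g x) :
    0 ≤ muExpect (measure m) (fun x => density m x * g x) := by
  rw [muExpect_density_mul]
  refine div_nonneg ?_ (normConst_pos hm).le
  -- for `i ∉ S`, `g(e_i) = g(𝟎)`
  have hgi : ∀ i, i ∉ S → g (unitVec i) = g (fun _ => false) := by
    intro i hi
    refine hg _ _ fun j hj => ?_
    have : j ≠ i := fun h => hi (h ▸ hj)
    simp [unitVec, this]
  classical
  have hsum : ∑ i, g (unitVec i) = ∑ i ∈ S, g (unitVec i) + (m - S.card : ℝ) * g (fun _ => false) := by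
    rw [← Finset.sum_add_sum_compl S (fun i => g (unitVec i))]
    congr 1
    rw [sum_congr rfl (fun i hi => hgi i (Finset.mem_compl.mp hi)), sum_const, nsmul_eq_mul,
      card_compl, Fintype.card_fin, Nat.cast_sub (by
        have := S.card_le_univ; simpa using this)]
  rw [hsum]
  have hq : (0 : ℝ) < 1 - 2 / m := by linarith [two_div_lt_one hm]
  have hm3 : (3 : ℝ) ≤ m := by exact_mod_cast hm
  have hS' : 2 * ((S.card : ℝ) - 1) ≤ m := by
    have h1 : ((2 * (S.card - 1) : ℕ) : ℝ) ≤ m := by exact_mod_cast hS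
    rcases Nat.eq_zero_or_pos S.card with h0 | hpos
    · rw [h0]; simp; linarith
    · push_cast [Nat.cast_sub hpos] at h1; linarith
  have hsumS : 0 ≤ ∑ i ∈ S, g (unitVec i) := sum_nonneg fun i _ => hg0 _
  have hg00 : 0 ≤ g (fun _ => false) := hg0 _
  -- `−α g(0) + β (m − |S|) g(0) = (1−2/m)^{m−1} (1 − 2(|S|−1)/m) g(0) ≥ 0`
  have hpow : (1 - 2 / (m : ℝ)) ^ m = (1 - 2 / m) ^ (m - 1) * (1 - 2 / m) := by
    rw [← pow_succ]; congr 1; omega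
  rw [hpow]
  have hkey : 0 ≤ -( (1 - 2 / (m : ℝ)) * g (fun _ => false)) +
      2 / m * ((m - S.card : ℝ) * g (fun _ => false)) := by
    have : -( (1 - 2 / (m : ℝ)) * g (fun _ => false)) + 2 / m * ((m - S.card : ℝ) * g (fun _ => false))
        = (1 - 2 * ((S.card : ℝ) - 1) / m) * g (fun _ => false) := by
      field_simp; ring
    rw [this]
    refine mul_nonneg ?_ hg00
    rw [sub_nonneg, div_le_one (by linarith)]
    exact hS'
  have hq' : 0 ≤ (1 - 2 / (m : ℝ)) ^ (m - 1) := pow_nonneg hq.le _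
  have hrw : -((1 - 2 / (m : ℝ)) ^ (m - 1) * (1 - 2 / m) * g (fun _ => false)) +
      2 / m * (1 - 2 / m) ^ (m - 1) * (∑ i ∈ S, g (unitVec i) + (m - S.card : ℝ) * g (fun _ => false))
      = (1 - 2 / (m : ℝ)) ^ (m - 1) * (-((1 - 2 / (m : ℝ)) * g (fun _ => false)) +
          2 / m * ((m - S.card : ℝ) * g (fun _ => false))) +
        2 / m * (1 - 2 / m) ^ (m - 1) * ∑ i ∈ S, g (unitVec i) := by ring
  rw [hrw]
  have h2m : (0 : ℝ) ≤ 2 / m := by positivity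
  exact add_nonneg (mul_nonneg hq' hkey) (mul_nonneg (mul_nonneg h2m hq') hsumS)

/-- `D` is a `d`-local pseudo-density for every `d` with `2(d − 1) ≤ m`, i.e. `d ≤ m/2 + 1`.
[cite: LeeRaghavendraSteurer2015, Lemma 7.3 (p. 28, proof: "as long as d ≤ m/2 + 1, D is a d-local pseudo-density")] -/
theorem isLocalPseudoDensity_density (hm : 3 ≤ m) {d : ℕ} (hd : 2 * (d - 1) ≤ m) :
    IsLocalPseudoDensity (measure m) d (density m) := by
  refine ⟨muExpect_density hm, fun g hg hg0 => ?_⟩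
  obtain ⟨S, hS, hgS⟩ := hg
  exact muExpect_density_mul_nonneg hm (by omega) hgS hg0

/-- `E_{μ^m}[D f] = −α/Z = −(m − 2)/(m + 2)`. [cite: LeeRaghavendraSteurer2015, Lemma 7.3 (p. 28, proof: "E D f = −1")] -/
theorem muExpect_density_mul_quadric (hm : 3 ≤ m) :
    muExpect (measure m) (fun x => density m x * quadric m x) = -(((m : ℝ) - 2) / (m + 2)) := by
  rw [muExpect_density_mul]
  have hq : ∀ i : Fin m, quadric m (unitVec i) = 0 := fun i => by simp [quadric]
  have h0 : quadric m (fun _ => false) = 1 := by simp [quadric]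
  simp only [hq, sum_const_zero, mul_zero, add_zero, h0, mul_one]
  have hm3 : (3 : ℝ) ≤ m := by exact_mod_cast hm
  have hpow : (1 - 2 / (m : ℝ)) ^ m = (1 - 2 / m) ^ (m - 1) * (1 - 2 / m) := by
    rw [← pow_succ]; congr 1; omega
  have hq' : (0 : ℝ) < (1 - 2 / (m : ℝ)) ^ (m - 1) := pow_pos (by linarith [two_div_lt_one hm]) _
  rw [normConst, hpow, neg_div, mul_div_mul_left _ _ hq'.ne', neg_inj]
  have hm0 : (m : ℝ) ≠ 0 := Nat.cast_ne_zero.mpr (by omega)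
  have hm2 : (m : ℝ) + 2 ≠ 0 := by positivity
  rw [div_eq_div_iff (by positivity) hm2]
  field_simp

/-! ### Size of the witness: `‖D‖_∞ ≤ (1 − 2/m)^{−m} ≤ e^6` -/

/-- `(1 − 2/m)^m ≥ e^{−6}` for `m ≥ 3` (from `log(1 − 2/m) ≥ 1 − (1 − 2/m)⁻¹ = −2/(m − 2)`).
[cite: LeeRaghavendraSteurer2015, Lemma 7.3 (p. 28, proof: "‖D‖_∞ = (1 − 2/m)^{−m} ≤ 27")] -/
theorem exp_neg_six_le_alpha (hm : 3 ≤ m) : Real.exp (-6) ≤ (1 - 2 / (m : ℝ)) ^ m := by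
  have hm3 : (3 : ℝ) ≤ m := by exact_mod_cast hm
  set q : ℝ := 1 - 2 / m with hq
  have hqpos : 0 < q := by rw [hq]; linarith [two_div_lt_one hm]
  have hlog : -6 ≤ (m : ℝ) * Real.log q := by
    have h1 : 1 - q⁻¹ ≤ Real.log q := Real.one_sub_inv_le_log_of_pos hqpos
    -- `1 − q⁻¹ = −2/(m−2)` and `m · 2/(m−2) ≤ 6`
    have hm2 : (0 : ℝ) < m - 2 := by linarith
    have h2 : 1 - q⁻¹ = -(2 / (m - 2)) := by
      rw [hq]; field_simp; ring
    have h3 : (m : ℝ) * (2 / (m - 2)) ≤ 6 := by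
      rw [mul_div_assoc', div_le_iff₀ hm2]; linarith
    have h4 : (m : ℝ) * (1 - q⁻¹) ≤ m * Real.log q := mul_le_mul_of_nonneg_left h1 (by linarith)
    rw [h2] at h4
    linarith
  calc Real.exp (-6) ≤ Real.exp (m * Real.log q) := Real.exp_le_exp.mpr hlog
    _ = q ^ m := by rw [Real.exp_nat_mul, Real.exp_log hqpos]

/-- `‖D‖_∞ ≤ 1/Z ≤ (1 − 2/m)^{−m} ≤ e^6`. [cite: LeeRaghavendraSteurer2015, Lemma 7.3 (p. 28, proof: "‖D‖_∞ = |D(𝟎)| = (1 − 2/m)^{−m} ≤ 27")] -/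
theorem norm_density_le (hm : 3 ≤ m) : ‖density m‖ ≤ Real.exp 6 := by
  have hZ := normConst_pos hm
  have hq : (0 : ℝ) < 1 - 2 / m := by linarith [two_div_lt_one hm]
  have hq1 : 1 - 2 / (m : ℝ) ≤ 1 := by
    have : (0 : ℝ) ≤ 2 / m := by positivity
    linarith
  -- `Z ≥ (1 − 2/m)^m ≥ e^{−6}`
  have hZα : (1 - 2 / (m : ℝ)) ^ m ≤ normConst m := by
    unfold normConst
    have hpow : (1 - 2 / (m : ℝ)) ^ m = (1 - 2 / m) ^ (m - 1) * (1 - 2 / m) := by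
      rw [← pow_succ]; congr 1; omega
    rw [hpow]
    refine mul_le_mul_of_nonneg_left ?_ (pow_nonneg hq.le _)
    have : (0 : ℝ) ≤ 2 / m := by positivity
    linarith
  have hZ6 : Real.exp (-6) ≤ normConst m := (exp_neg_six_le_alpha hm).trans hZα
  have hbound : 1 / normConst m ≤ Real.exp 6 := by
    rw [div_le_iff₀ hZ, ← div_le_iff₀' (Real.exp_pos 6), div_eq_mul_inv, one_mul, ← Real.exp_neg]
    exact hZ6
  refine (pi_norm_le_iff_of_nonneg (by positivity)).mpr fun x => ?_
  rw [Real.norm_eq_abs]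
  refine le_trans ?_ hbound
  unfold density signPattern
  rw [abs_div, abs_of_pos hZ]
  refine div_le_div_of_nonneg_right ?_ hZ.le
  split_ifs <;> simp

/-! ### `E_{μ^m} f = 3 − 4/m` -/

/-- Product moments of the biased cube: `E_{μ^m}[Π_{i∈T} x_i] = μ(1)^{|T|}` for a probability weight
`μ` on `{0,1}`. [cite: LeeRaghavendraSteurer2015, Lemma 7.3 (p. 28, proof: "it is easy to see that E_{μ^m} f ≥ Ω(1)")] -/
theorem muExpect_prod_indicator {μ : Bool → ℝ} (hμ : IsProbWeight μ) (T : Finset (Fin m)) :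
    muExpect (prodWeight μ m) (fun x => ∏ i ∈ T, (if x i then (1 : ℝ) else 0)) = μ true ^ T.card := by
  classical
  unfold muExpect prodWeight piWeight
  have h1 : ∀ x : Fin m → Bool, (∏ i, μ (x i)) * ∏ i ∈ T, (if x i then (1 : ℝ) else 0) =
      ∏ i, (μ (x i) * if i ∈ T then (if x i then (1 : ℝ) else 0) else 1) := by
    intro x
    rw [← Finset.prod_ite_mem_eq T (fun i => if x i then (1 : ℝ) else 0), ← prod_mul_distrib]
  simp_rw [h1]
  rw [← Fintype.piFinset_univ, Finset.sum_prod_piFinset (univ : Finset Bool)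
    (fun i b => μ b * if i ∈ T then (if b then (1 : ℝ) else 0) else 1)]
  have h2 : ∀ i : Fin m, (∑ b : Bool, μ b * if i ∈ T then (if b then (1 : ℝ) else 0) else 1) =
      if i ∈ T then μ true else 1 := by
    intro i
    have hsum : μ true + μ false = 1 := by
      have := hμ.sum_eq_one; simpa [Fintype.sum_bool] using this
    split_ifs with hi
    · simp
    · simp only [mul_one, Fintype.sum_bool]; exact hsum
  simp_rw [h2]
  rw [Finset.prod_ite_mem_eq, prod_const]

/-- **`E_{μ^m} f = 3 − 4/m`** for `f = (1 − Σ x_i)²` and `μ(1) = 2/m` (`m ≥ 3`).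
[cite: LeeRaghavendraSteurer2015, Lemma 7.3 (p. 28, proof: "E_{μ^m} f ≥ Ω(1)")] -/
theorem muExpect_quadric (hm : 3 ≤ m) : muExpect (measure m) (quadric m) = 3 - 4 / m := by
  classical
  have hμ := isProbWeight_weight hm
  have hμm := isProbWeight_measure hm
  have hp : weight m true = 2 / m := by simp [weight]
  have hm0 : (m : ℝ) ≠ 0 := Nat.cast_ne_zero.mpr (by omega)
  -- indicator variables
  set X : Fin m → (Fin m → Bool) → ℝ := fun i x => if x i then 1 else 0 with hX
  have hcard : ∀ x : Fin m → Bool, ((trueSet x).card : ℝ) = ∑ i, X i x := by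
    intro x
    rw [trueSet, Finset.card_filter]
    push_cast
    exact sum_congr rfl fun i _ => by simp [hX]
  -- second moments
  have hXX : ∀ (i j : Fin m) (x : Fin m → Bool), X i x * X j x = ∏ k ∈ ({i, j} : Finset (Fin m)), X k x := by
    intro i j x
    by_cases hij : i = j
    · subst hij
      rw [show ({i, i} : Finset (Fin m)) = {i} from Finset.insert_eq_of_mem (Finset.mem_singleton_self i),
        prod_singleton]
      by_cases hx : x i = true <;> simp [hX, hx]
    · rw [prod_pair hij]
  have hE1 : ∀ i : Fin m, muExpect (measure m) (X i) = 2 / m := by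
    intro i
    have := muExpect_prod_indicator (m := m) hμ {i}
    simp only [prod_singleton, card_singleton, pow_one] at this
    rw [hp] at this
    exact this
  have hE2 : ∀ i j : Fin m, muExpect (measure m) (fun x => X i x * X j x) =
      if i = j then (2 : ℝ) / m else ((2 : ℝ) / m) ^ 2 := by
    intro i j
    simp_rw [hXX i j]
    rw [show measure m = prodWeight (weight m) m from rfl, muExpect_prod_indicator hμ {i, j}, hp]
    by_cases hij : i = j
    · subst hij; simp
    · rw [card_pair hij, if_neg hij]
  -- expand the square
  have hf : ∀ x, quadric m x = (1 - 2 * ∑ i, X i x) + ∑ i, ∑ j, X i x * X j x := by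
    intro x
    rw [quadric, hcard x, ← sum_mul_sum]
    ring
  have hEsum : ∀ (g : Fin m → (Fin m → Bool) → ℝ),
      muExpect (measure m) (fun x => ∑ i, g i x) = ∑ i, muExpect (measure m) (g i) := by
    intro g
    simp only [muExpect, mul_sum]
    rw [sum_comm]
  have hlin : muExpect (measure m) (quadric m) =
      1 - 2 * ∑ i, muExpect (measure m) (X i) +
        ∑ i, ∑ j, muExpect (measure m) (fun x => X i x * X j x) := by
    rw [muExpect_congr hf, muExpect_add, muExpect_sub, hμm.muExpect_const, muExpect_const_mul,
      hEsum, hEsum]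
    simp only [hEsum]
  rw [hlin]
  simp only [hE1, hE2, sum_const, card_univ, Fintype.card_fin, nsmul_eq_mul]
  have hinner : ∀ i : Fin m, (∑ j : Fin m, if i = j then (2 : ℝ) / m else ((2 : ℝ) / m) ^ 2) =
      2 / m + ((m : ℝ) - 1) * (2 / m) ^ 2 := by
    intro i
    rw [← Finset.add_sum_erase univ _ (mem_univ i), if_pos rfl,
      sum_congr rfl (fun j hj => if_neg (fun h => (ne_of_mem_erase hj) h.symm)), sum_const,
      card_erase_of_mem (mem_univ i), card_univ, Fintype.card_fin, nsmul_eq_mul,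
      Nat.cast_sub (by omega : 1 ≤ m), Nat.cast_one]
  simp only [hinner, sum_const, card_univ, Fintype.card_fin, nsmul_eq_mul]
  field_simp
  ring

/-! ### Lemma 7.3 -/

/-- The constant `ε₀ = e^{−6}/16`. [cite: LeeRaghavendraSteurer2015, Lemma 7.3 (p. 28)] -/
def eps0 : ℝ := Real.exp (-6) / 16

/-- `ε₀ > 0`. [cite: LeeRaghavendraSteurer2015, Lemma 7.3 (p. 28: "a constant ε₀ > 0")] -/
theorem eps0_pos : 0 < eps0 := by unfold eps0; positivity

/-- **Lee–Raghavendra–Steurer 2015, Lemma 7.3 (witness form).** For every `m ≥ 3` the density `D`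
is `d`-local w.r.t. `μ^m` for every `d ≤ m/2 + 1` (i.e. `2(d−1) ≤ m`) and
`E_{μ^m}[D f] < −ε₀ ‖D‖_∞ E_{μ^m} f` with the universal `ε₀ = e^{−6}/16`.
[cite: LeeRaghavendraSteurer2015, Lemma 7.3 (p. 28)] -/
theorem _root_.Literature.Combinatorics.Optimization.LeeRaghavendraSteurer2015_lemma73
    (hm : 3 ≤ m) {d : ℕ} (hd : 2 * (d - 1) ≤ m) :
    IsLocalPseudoDensity (measure m) d (density m) ∧
      muExpect (measure m) (fun x => density m x * quadric m x) <
        -(eps0 * ‖density m‖ * muExpect (measure m) (quadric m)) := by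
  refine ⟨isLocalPseudoDensity_density hm hd, ?_⟩
  rw [muExpect_density_mul_quadric hm, muExpect_quadric hm]
  have hm3 : (3 : ℝ) ≤ m := by exact_mod_cast hm
  have hD := norm_density_le hm
  have hD0 : 0 ≤ ‖density m‖ := norm_nonneg _
  have h4m : (0 : ℝ) ≤ 4 / m := by positivity
  have hEf : (3 : ℝ) - 4 / m ≤ 3 := by linarith
  have hEf0 : (0 : ℝ) ≤ 3 - 4 / m := by
    rw [sub_nonneg, div_le_iff₀ (by linarith)]; linarith
  -- `ε₀ ‖D‖ E f ≤ (e^{-6}/16) e^6 · 3 = 3/16 < 1/5 ≤ (m−2)/(m+2)`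
  have h1 : eps0 * ‖density m‖ * (3 - 4 / m) ≤ 3 / 16 := by
    calc eps0 * ‖density m‖ * (3 - 4 / m) ≤ eps0 * Real.exp 6 * 3 := by
          unfold eps0
          gcongr
      _ = 3 / 16 := by unfold eps0; rw [div_mul_eq_mul_div, ← Real.exp_add]; norm_num
  have h2 : (1 : ℝ) / 5 ≤ ((m : ℝ) - 2) / (m + 2) := by
    rw [div_le_div_iff₀ (by norm_num) (by linarith)]; linarith
  linarith

/-- **Lemma 7.3 as printed: `juntadeg^{ε₀}(f; μ^m) ≥ m/2 + 1`** (indeed `≥ ⌊m/2⌋ + 2`).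
[cite: LeeRaghavendraSteurer2015, Lemma 7.3 (p. 28)] -/
theorem _root_.Literature.Combinatorics.Optimization.LeeRaghavendraSteurer2015_lemma73_approxJuntaDegree (hm : 3 ≤ m) :
    m / 2 + 2 ≤ approxJuntaDegree eps0 (measure m) (quadric m) := by
  have h := LeeRaghavendraSteurer2015_lemma73 hm (d := m / 2 + 1) (by omega)
  unfold approxJuntaDegree
  set s := {d' | ∃ d : ℕ, d' = d + 1 ∧ ∃ D : (Fin m → Bool) → ℝ, IsLocalPseudoDensity (measure m) d D ∧
    muExpect (measure m) (fun x => D x * quadric m x) <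
      -(eps0 * ‖D‖ * muExpect (measure m) (quadric m))} with hs
  have hmem : m / 2 + 2 ∈ s := ⟨m / 2 + 1, by omega, density m, h.1, h.2⟩
  -- the set is bounded (witnesses have `d + 1 ≤ m + 1`: a `d`-local density with `d ≥ m` is nonnegative against `f`)
  have hbdd : BddAbove s := by
    refine ⟨m + 1, fun d' hd' => ?_⟩
    obtain ⟨d, rfl, D, hD, hDf⟩ := hd'
    by_contra hlt
    have hmd : m ≤ d := by omega
    -- `f` is a nonnegative `m`-junta, hence `E[D f] ≥ 0`, contradicting `hDf`
    have hf0 : ∀ x, 0 ≤ quadric m x := fun x => sq_nonneg _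
    have hfj : IsKJunta d (quadric m) :=
      ⟨univ, by simp; omega, fun x y hxy => by rw [show x = y from funext fun i => hxy i (mem_univ i)]⟩
    have h0 := hD.2 _ hfj hf0
    have hpos : 0 ≤ eps0 * ‖D‖ * muExpect (measure m) (quadric m) :=
      mul_nonneg (mul_nonneg eps0_pos.le (norm_nonneg _)) ((isProbWeight_measure hm).muExpect_nonneg hf0)
    linarith
  exact le_csSup hbdd hmem

/-! ### Theorem 7.4 -/

/-- `‖f‖_∞ ≤ m²` for the quadric `(1 − |x|)²` on `{0,1}^m`, `m ≥ 1`. [cite: LeeRaghavendraSteurer2015, Thm 7.4 (proof via Thm 7.2: the term log(‖f‖_∞/‖f‖₁))] -/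
theorem norm_quadric_le (hm : 1 ≤ m) : ‖quadric m‖ ≤ (m : ℝ) ^ 2 := by
  refine (pi_norm_le_iff_of_nonneg (by positivity)).mpr fun x => ?_
  rw [Real.norm_eq_abs, quadric, abs_of_nonneg (sq_nonneg _), ← sq_abs]
  refine pow_le_pow_left₀ (abs_nonneg _) (abs_le.mpr ⟨?_, ?_⟩) 2
  · have : ((trueSet x).card : ℝ) ≤ m := by
      have h := (trueSet x).card_le_univ
      rw [Fintype.card_fin] at h
      exact_mod_cast h
    linarith
  · have : (0 : ℝ) ≤ (trueSet x).card := Nat.cast_nonneg _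
    have : (1 : ℝ) ≤ m := by exact_mod_cast hm
    linarith

/-- `log(3/ε₀) = log 48 + 6 < 10`. [cite: LeeRaghavendraSteurer2015, Thm 7.4 (p. 28: the universal constant c)] -/
theorem log_three_div_eps0_lt : Real.log (3 / eps0) < 10 := by
  have h48 : (3 : ℝ) / eps0 = 48 * Real.exp 6 := by
    unfold eps0; rw [Real.exp_neg]; field_simp; norm_num
  rw [h48, Real.log_mul (by norm_num) (Real.exp_pos 6).ne', Real.log_exp]
  have : Real.log 48 < 4 := by
    rw [Real.log_lt_iff_lt_exp (by norm_num)]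
    have h1 := Real.exp_one_gt_d9
    have h4 : Real.exp 4 = Real.exp 1 ^ 4 := by rw [← Real.exp_nat_mul]; norm_num
    rw [h4]
    have : (2.7182818283 : ℝ) ^ 4 < Real.exp 1 ^ 4 :=
      pow_lt_pow_left₀ h1 (by norm_num) (by norm_num)
    linarith [show (48 : ℝ) < 2.7182818283 ^ 4 by norm_num]
  linarith

/-- `log n > 5/3` for `n ≥ 6` (`log 6 = log 2 + log 3 > 0.69 + 1`). [cite: LeeRaghavendraSteurer2015, Thm 7.4 (p. 28: the universal constant c)] -/
theorem log_gt_of_six_le {n : ℕ} (hn : 6 ≤ n) : (5 : ℝ) / 3 < Real.log n := by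
  have h6 : Real.log 6 ≤ Real.log n :=
    Real.log_le_log (by norm_num) (by exact_mod_cast hn)
  have hlog6 : Real.log 6 = Real.log 2 + Real.log 3 := by
    rw [show (6 : ℝ) = 2 * 3 by norm_num, Real.log_mul (by norm_num) (by norm_num)]
  have h2 := Real.log_two_gt_d9
  have h3 : 1 < Real.log 3 := by
    rw [Real.lt_log_iff_exp_lt (by norm_num)]
    have := Real.exp_one_lt_d9
    linarith
  linarith

set_option maxHeartbeats 400000 in
/-- **Lee–Raghavendra–Steurer 2015, Theorem 7.4 (nonnegative rank of the lopsided pattern matrix).**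
There is a constant `c > 0` such that for every `m ≥ 3` and `n ≥ 2m`, the pattern matrix `M_n^f` of
`f(x) = (1 − Σ_i x_i)²` (rows: `m`-subsets `S ⊆ [n]`, columns: `x ∈ {0,1}ⁿ`, entry `f(x_S)`) has
`nnr(M_n^f) ≥ (c n/(m³ log n))^{m/2}`: no nonnegative factorisation of size `r` exists unless
`r ≥ (c n/(m³ log n))^{m/2}`.  PROVED with the explicit `c = (ε₀/3)²·ε₀²/192`, `ε₀ = e^{−6}/16`, from
Theorem 7.2 (lower bound, `LeeRaghavendraSteurer2015_thm72_lower'`, `d = ⌊m/2⌋ + 1`) and Lemma 7.3.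
[cite: LeeRaghavendraSteurer2015, Thm 7.4 (p. 28)] -/
theorem _root_.Literature.Combinatorics.Optimization.LeeRaghavendraSteurer2015_thm74 :
    ∃ c : ℝ, 0 < c ∧ ∀ m : ℕ, 3 ≤ m → ∀ n : ℕ, 2 * m ≤ n → ∀ r : ℕ,
      HasNonnegFactorization (generalPatternMatrix n (quadric m)) r →
        (c * n / ((m : ℝ) ^ 3 * Real.log n)) ^ ((m : ℝ) / 2) ≤ r := by
  refine ⟨(eps0 / 3) ^ 2 * (eps0 ^ 2 / 192), by have := eps0_pos; positivity, ?_⟩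
  intro m hm n hn r hr
  have hε := eps0_pos
  have hε1' : eps0 ≤ 1 := by
    unfold eps0
    have : Real.exp (-6) ≤ 1 := Real.exp_le_one_iff.mpr (by norm_num)
    linarith
  have hε1 : eps0 / 3 ≤ 1 := by linarith
  -- sizes
  have hm3 : (3 : ℝ) ≤ m := by exact_mod_cast hm
  have hm0 : (0 : ℝ) < m := by linarith
  have hn6 : 6 ≤ n := by omega
  have hn6' : (6 : ℝ) ≤ n := by exact_mod_cast hn6
  have hn0 : (0 : ℝ) < n := by linarith
  have hlogn : (5 : ℝ) / 3 < Real.log n := log_gt_of_six_le hn6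
  have hlogn1 : 1 ≤ Real.log n := by linarith
  have hmlog : 5 < (m : ℝ) * Real.log n := by
    calc (5 : ℝ) < 3 * Real.log n := by linarith
      _ ≤ m * Real.log n := mul_le_mul_of_nonneg_right hm3 (by linarith)
  -- `‖f‖₁ = 3 − 4/m ≥ 1`, `4 ≤ ‖f‖_∞ ≤ m²`
  have hF₁ : muExpect (prodWeight (weight m) m) (quadric m) = 3 - 4 / m := muExpect_quadric hm
  have h4m : (4 : ℝ) / m ≤ 2 := by rw [div_le_iff₀ hm0]; linarith
  have hF₁1 : (1 : ℝ) ≤ 3 - 4 / m := by linarith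
  have hfn : ‖quadric m‖ ≤ (m : ℝ) ^ 2 := norm_quadric_le (by omega)
  have hfn4 : (4 : ℝ) ≤ ‖quadric m‖ := by
    have h1 : quadric m (fun _ => true) = (1 - (m : ℝ)) ^ 2 := by
      simp [quadric, trueSet]
    have h2 := abs_apply_le_norm (quadric m) (fun _ => true)
    rw [h1, abs_of_nonneg (sq_nonneg _)] at h2
    have h3 : (2 : ℝ) ^ 2 ≤ (1 - (m : ℝ)) ^ 2 := by
      rw [← neg_sub, neg_sq]
      exact pow_le_pow_left₀ (by norm_num) (by linarith) 2
    linarith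
  have hfn0 : 0 < ‖quadric m‖ := by linarith
  -- Lemma 7.3 at level `d = ⌊m/2⌋ + 1` and Theorem 7.2
  set d : ℕ := m / 2 + 1 with hd
  obtain ⟨hD, hDf⟩ := LeeRaghavendraSteurer2015_lemma73 hm (d := d) (by omega)
  have hf0 : ∀ y, 0 ≤ quadric m y := fun y => sq_nonneg _
  have hmain := LeeRaghavendraSteurer2015_thm72_lower' (f := quadric m) (isProbWeight_weight hm) hn
    hf0 hε hD hDf hr
  rw [hF₁] at hmain
  -- the denominator `L ≤ 4 m log n`
  set L : ℝ := ((d : ℝ) + 1) * Real.log n + Real.log (‖quadric m‖ / (3 - 4 / m)) +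
    Real.log (3 / eps0) with hL
  have hd1 : ((d : ℝ) + 1) ≤ m := by
    have : d + 1 ≤ m := by omega
    exact_mod_cast this
  have hL1 : ((d : ℝ) + 1) * Real.log n ≤ m * Real.log n :=
    mul_le_mul_of_nonneg_right hd1 (by linarith)
  have hL2 : Real.log (‖quadric m‖ / (3 - 4 / m)) ≤ m * Real.log n := by
    have h1 : ‖quadric m‖ / (3 - 4 / m) ≤ (m : ℝ) ^ 2 := by
      rw [div_le_iff₀ (by linarith)]
      calc ‖quadric m‖ ≤ (m : ℝ) ^ 2 := hfn
        _ = (m : ℝ) ^ 2 * 1 := by ring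
        _ ≤ (m : ℝ) ^ 2 * (3 - 4 / m) := mul_le_mul_of_nonneg_left hF₁1 (by positivity)
    have h2 : Real.log (‖quadric m‖ / (3 - 4 / m)) ≤ Real.log ((m : ℝ) ^ 2) :=
      Real.log_le_log (div_pos hfn0 (by linarith)) h1
    rw [Real.log_pow] at h2
    have h3 : Real.log m ≤ Real.log n :=
      Real.log_le_log hm0 (by exact_mod_cast (by omega : m ≤ n))
    have h5 : 2 * Real.log n ≤ m * Real.log n :=
      mul_le_mul_of_nonneg_right (by linarith) (by linarith)
    push_cast at h2
    linarith
  have hL3 : Real.log (3 / eps0) ≤ 2 * (m * Real.log n) := by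
    have := log_three_div_eps0_lt; linarith
  have hL4 : L ≤ 4 * (m * Real.log n) := by rw [hL]; linarith
  have hLpos : 0 < L := by
    rw [hL]
    have h1 : 0 ≤ ((d : ℝ) + 1) * Real.log n := by positivity
    have h4m0 : (0 : ℝ) ≤ 4 / m := by positivity
    have h2 : 0 ≤ Real.log (‖quadric m‖ / (3 - 4 / m)) :=
      Real.log_nonneg (by rw [le_div_iff₀ (by linarith)]; linarith)
    have h3 : 0 < Real.log (3 / eps0) := Real.log_pos (by rw [lt_div_iff₀ hε]; linarith)
    linarith
  -- `B = ε₀² n/(192 m³ log n) ≤ base`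
  set base : ℝ := eps0 ^ 2 * n / (48 * (m : ℝ) ^ 2 * L) with hbase
  set B : ℝ := eps0 ^ 2 * n / (192 * (m : ℝ) ^ 3 * Real.log n) with hB
  have hB0 : 0 ≤ B := by positivity
  have hBbase : B ≤ base := by
    rw [hB, hbase]
    apply div_le_div_of_nonneg_left (by positivity) (by positivity)
    calc 48 * (m : ℝ) ^ 2 * L ≤ 48 * (m : ℝ) ^ 2 * (4 * (m * Real.log n)) := by gcongr
      _ = 192 * (m : ℝ) ^ 3 * Real.log n := by ring
  have hBn : B ≤ n := by
    rw [hB, div_le_iff₀ (by positivity)]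
    have h1 : eps0 ^ 2 ≤ 1 := pow_le_one₀ hε.le hε1'
    have h2 : (1 : ℝ) ≤ 192 * (m : ℝ) ^ 3 * Real.log n := by
      have hm1 : (1 : ℝ) ≤ (m : ℝ) ^ 3 := one_le_pow₀ (by linarith)
      calc (1 : ℝ) = 1 * 1 := by ring
        _ ≤ 192 * (m : ℝ) ^ 3 * Real.log n :=
            mul_le_mul (by linarith) hlogn1 (by norm_num) (by positivity)
    calc eps0 ^ 2 * n ≤ 1 * n := mul_le_mul_of_nonneg_right h1 hn0.le
      _ ≤ (192 * (m : ℝ) ^ 3 * Real.log n) * n := mul_le_mul_of_nonneg_right h2 hn0.le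
      _ = n * (192 * (m : ℝ) ^ 3 * Real.log n) := by ring
  -- the target quantity `Y = (ε₀/3)² B`
  have hY : (eps0 / 3) ^ 2 * (eps0 ^ 2 / 192) * n / ((m : ℝ) ^ 3 * Real.log n) =
      (eps0 / 3) ^ 2 * B := by
    rw [hB]; ring
  rw [hY]
  have hY0 : 0 ≤ (eps0 / 3) ^ 2 * B := by positivity
  -- `r ≥ 1`
  have hr1 : (1 : ℝ) ≤ r := by
    have : 0 < r := by
      rcases hmain with h | h
      · have h0 : (0 : ℝ) < (n : ℝ) ^ (d + 1) := by positivity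
        exact_mod_cast (h0.trans_le h)
      · have h0 : (0 : ℝ) ≤ eps0 / 3 * base ^ (d + 1) :=
          mul_nonneg (by positivity) (pow_nonneg (hB0.trans hBbase) _)
        exact_mod_cast (h0.trans_lt h)
    exact_mod_cast this
  by_cases hY1 : (eps0 / 3) ^ 2 * B ≤ 1
  · -- small base: the bound is at most `1 ≤ r`
    exact (Real.rpow_le_one hY0 hY1 (by positivity)).trans hr1
  · -- large base: `Y^{m/2} = (ε₀/3)^m B^{m/2} ≤ (ε₀/3) B^{d+1}`
    have hB1 : 1 ≤ B := by
      push Not at hY1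
      have h9 : (eps0 / 3) ^ 2 ≤ 1 := pow_le_one₀ (by positivity) hε1
      have : (eps0 / 3) ^ 2 * B ≤ 1 * B := mul_le_mul_of_nonneg_right h9 hB0
      linarith
    have hexp : ((m : ℝ) / 2) ≤ ((d + 1 : ℕ) : ℝ) := by
      have h1 : m ≤ 2 * (m / 2) + 1 := by omega
      have h2 : (m : ℝ) ≤ 2 * ((m / 2 : ℕ) : ℝ) + 1 := by exact_mod_cast h1
      rw [hd]; push_cast; linarith
    have hsplit : ((eps0 / 3) ^ 2 * B) ^ ((m : ℝ) / 2) = (eps0 / 3) ^ m * B ^ ((m : ℝ) / 2) := by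
      rw [Real.mul_rpow (by positivity) hB0]
      congr 1
      rw [← Real.rpow_natCast (eps0 / 3) 2, ← Real.rpow_mul (by positivity)]
      push_cast
      rw [show (2 : ℝ) * ((m : ℝ) / 2) = (m : ℝ) by ring, Real.rpow_natCast]
    have hpowε : (eps0 / 3) ^ m ≤ eps0 / 3 := pow_le_of_le_one (by positivity) hε1 (by omega)
    have hBpow : B ^ ((m : ℝ) / 2) ≤ B ^ (d + 1) := by
      rw [← Real.rpow_natCast B (d + 1)]
      exact Real.rpow_le_rpow_of_exponent_le hB1 hexp
    have hBpow0 : 0 ≤ B ^ ((m : ℝ) / 2) := Real.rpow_nonneg hB0 _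
    have hY_le : ((eps0 / 3) ^ 2 * B) ^ ((m : ℝ) / 2) ≤ eps0 / 3 * B ^ (d + 1) := by
      rw [hsplit]
      calc (eps0 / 3) ^ m * B ^ ((m : ℝ) / 2) ≤ eps0 / 3 * B ^ ((m : ℝ) / 2) :=
            mul_le_mul_of_nonneg_right hpowε hBpow0
        _ ≤ eps0 / 3 * B ^ (d + 1) := mul_le_mul_of_nonneg_left hBpow (by positivity)
    refine hY_le.trans ?_
    rcases hmain with h | h
    · -- `r ≥ n^{d+1} ≥ B^{d+1} ≥ (ε₀/3) B^{d+1}`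
      have h1 : B ^ (d + 1) ≤ (n : ℝ) ^ (d + 1) := pow_le_pow_left₀ hB0 hBn _
      have h2 : eps0 / 3 * B ^ (d + 1) ≤ 1 * B ^ (d + 1) :=
        mul_le_mul_of_nonneg_right hε1 (pow_nonneg hB0 _)
      linarith only [h, h1, h2]
    · -- `r > (ε₀/3) base^{d+1} ≥ (ε₀/3) B^{d+1}`
      have h1 : B ^ (d + 1) ≤ base ^ (d + 1) := pow_le_pow_left₀ hB0 hBbase _
      have h2 : eps0 / 3 * B ^ (d + 1) ≤ eps0 / 3 * base ^ (d + 1) :=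
        mul_le_mul_of_nonneg_left h1 (by positivity)
      linarith only [h, h2]

end Lopsided

end Literature.Combinatorics.Optimization
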